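import Summits.QuantumFields.BalabanUV.Beta.CombHId2TorusSym
import Summits.QuantumFields.BalabanUV.Beta.CombHId2W2Record

/-!
# `BalabanUV.Beta.CombHId2TorusRecord` — binder row D1 (OWNER an2), (J-a) dictionary, (C2) at ORDER 2 AT THE (III′) RECORD, PART THREE (letters, 2c-iii):
# **THE LATTICE SIDE OF THE DOOR's `hId₂` AT THE RECORD, HYPOTHESIS-FREE** — the coarse-torus matrix of the level-`(j+1)` second-order table of the comb-chart literal,
# bound the door's way, is `(cE₂·wV4)·` the multiplier entry at the coarse points of the torus polynomial
# `Â·D̂_b·Â·D̂_{b′}·Â + Â·D̂_{b′}·Â·D̂_b·Â − Â·Ŵ_{bb′}·Â` in the level-`j` torus matrices `+ (cB·wB2)·` the periodised border term; every letter READ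

WHY.  This closes the lattice side of N-an2-g44-1 (the PART THREE junction spec): leaf-05's `FP/CoarseJetOrderTwoGradedComb.torus_hId₂_iff_graded_comb` expresses the
door's `hId₂` as a polynomial `P(Θ, Θᴸ, Ŝ, Γ̂; H₁, H₂, Q₁₁, Q₁₂) = c • H′₂` in the blocks of `Â := perF M (GcombSh Lc j)`; the lattice side supplies `perF M′` of
`CombHId2W2Record.dper_tsum_T2comb_succ_read` monomial by monomial.  Here every socket of PART THREE letters 1–2 (`CombHId2Torus`, `CombHId2Folds`, `CombHId2FoldsSlots`,
`CombHId2TorusWords`, `CombHId2TorusSym`) is discharged by the record's letters BY NAME (`decays_GcombSh`, `shiftK_GcombSh`, `locStencil_SpureCombOf`, `SpureCombOf_translate`,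
`tabs.hM ∕ hMt`, `T2RecOf_loc ∕ _translate`, `locStencilFM_M2Of ∕ M2Of_translate`, `exists_farSmall_WcombOf`) — ONE hypothesis `hM : M = Lc·M′` remains.
WHAT ([folklore]; 0 `def`, 0 cited fact, 0 `def … : Prop`, 0 sorry; notation of the docstrings: `G := GcombSh Lc j`, `S^per κ u := dper M (SpureCombOf … j κ u)`,
`M^per ρ w := dper M (tabs.M j ρ w)`, `T2^{per,csf}`, `M2^{per,cs}` as in `CombHId2W2Record`, `Â := perF M G`, `D̂_b := perF M (dM G Lc S^per M^per b)`,
`Ŵ_{bb′} := perF M (W2SymOfK G Lc S^per M^per T2^{per,csf} M2^{per,cs} b b′)`): §1 `M2comb_periodCov` (the `(Tmix)` bridge), `W2SymOfK_comb_translate_inv`,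
`exists_decays_W2SymOfK_comb` (the `W` sockets of `CombHId2TorusWords` at the record — via `WcombOf_per_cs_eq` + C3d-i `W_family` + C3c `biLoc_tsum_family` + gan24-p3's
`decays_dper_diag`); §2 **`perF_dper_tsum_T2comb_succ_inl_inl (hM) (j) (μ y ν y′) (y₁ y₂ m₁ m₂)`** — THE CROWN: `perF M′ (dper M′ (x z ↦ Σ'_n T2_{j+1} μ y ν (y′+M′∘n) x z)) ((y₁, inl m₁),(y₂, inl m₂))
= (cE₂·wV4 (j+1)) · (Â·D̂_{μy}·Â·D̂_{νy′}·Â + Â·D̂_{νy′}·Â·D̂_{μy}·Â − Â·Ŵ·Â)((wrapPt M (Lc•y₁), inr m₁),(wrapPt M (Lc•y₂), inr m₂)) + (cB·wB2 (j+1)) · perF M′ (vh₂S^{per,cs} μ y ν y′)((y₁, inl m₁),(y₂, inl m₂))`;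
§3 the letters of the polynomial READ at the record: **`perF_dM_comb`** (`D̂_b = perF M (vertexOfK G Lc S^per b) + perF M (vertexOfM G Lc M^per b)`), **`perF_vertexOfK_comb_apply`** (`Θ`-columns ×
`perF M (S^per κ u)`), **`perF_vertexOfM_comb_apply`** (`Ŝ`-columns × `perF M (M^per ρ w)`), **`perF_W2SymOfK_comb`** (`Ŵ = ½•(perF(W2OfK b b′) + perF(W2OfK b′ b))`), **`perF_W2OfK_comb`** (the four words),
**`perF_vertex2OfK_comb`** (`Θ Θ` × `perF M (T2^{per,csf} κ u κ′ u′)` — `H₂`'s binding), **`perF_mixOfK_comb`** (`Θ Ŝ` × `perF M (M2^{per,cs} κ u ρ w)` — `Q₁₂`'s binding), **`perF_resp_comb`**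
(the response word: `−(Â·D̂_{b′}·Â)`-columns × the level-`j` first-order tables' matrices).
NOT HERE: the torus ALGEBRA matching these readings with leaf-05's `V₁ ∕ W₁ ∕ X` polynomial (the junction cert `FP/CoarseJetOrderTwoGradedCombJunction`, leaf-05's per W-1
l.50006), the `d + 1 = 4` literal's `tabs := symTablesAn1S2`, any estimate; nothing of Bałaban's asserted; `D1Tel` ∕ `D1Rep` OPEN; NOT (T-ID), NOT (J-a) complete, NOT D1,
NEVER «G-an2-4 closed», NOT BetaPertH, NOT continuum, NOT Clay.

HONEST DEPENDENCY (page 1, mandatory): continuum YM on T⁴ ⇐ BetaPertH ∧ nine spine estimates (0/9 proved); BetaPertH ⇐ (D1) ∧ (D4) ∧ CAP+tail;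
G-an2-4 gates asym, D1 and NE2/3/4.  HONEST FRAMING (cell contract, verbatim): «discharging `BetaPertH` makes Bałaban's UV stability UNCONDITIONAL —
a real constructive-QFT result; it is NOT the continuum limit and NOT the Clay problem.»  ABSOLUTE RULE (cell charter, verbatim): «No internally-minted
statement may enter as a cited fact. Every hypothesis is either kernel-proved in this package or a verbatim quotation of a PUBLISHED theorem with page
reference. The manuscript(s) under audit are NOT citable for their own disputed steps — they are the thing under adjudication; programme-internal
(2001/route/tribunal) claims are never citable.»  Row D1 OWNER an2 (b2b-balaban-beta-an2) gen 45, 2026-08-23; over PART THREE letters 1–2 and `CombHId2W2Record` ∕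
`CombHId2Record` BY NAME.  No existing file touched.
-/

noncomputable section

open scoped BigOperators Matrix

namespace Summit.QuantumFields.BalabanUV.Beta.CombHId2TorusRecord

open Literature.MathematicalPhysics.QuantumFieldTheory.Balaban1983to89
open Literature.MathematicalPhysics.QuantumFieldTheory.Balaban1983to89.Beta
open B4TorusKernel.MultiPeriod (translate translate_apply)
open ExpKernelCalculus (MKer Decays BiLoc VertexFamily shiftK)
open AffineAveraging (Site)
open OneStepResolventKernel (Fib LocStencil)
open BalabanStepW2 (wV4 wB2 M2Of M2Of_translate)
open SecondOrderResponse (vertexOfM dM K2OfK vertex2OfK mixOfK W2OfK W2SymOfK LocStencilFM)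
open OneStepKernelFamily (vertexOfK)
open Summit.QuantumFields.BalabanUV.Beta.SpineRooted (T2RecOf)
open Summit.QuantumFields.BalabanUV.Beta.FP.KernelPeriodisationFib (Idx perF perZ)
open Summit.QuantumFields.BalabanUV.Beta.FP.KernelPeriodisationFibLoc (dper dper_translate decays_dper_diag)
open Summit.QuantumFields.BalabanUV.Beta.FP.TorusGaugeCovariancePairing (wrapPt)
open Summit.QuantumFields.BalabanUV.Beta.SymmetrisedStepJets (SymTables)
open Summit.QuantumFields.BalabanUV.Beta.CombChartStepJets (GcombSh SpureCombOf WcombOf locStencil_SpureCombOf decays_GcombSh)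
open B6Lemma24Torus (pbox)
open Summit.QuantumFields.BalabanUV.Beta.CombHId1Letters (perZ_coarse_col_eq_perF)
open Summit.QuantumFields.BalabanUV.Beta.CombHId1Sandwich (perF_vertexOfK_dper_apply)
open Summit.QuantumFields.BalabanUV.Beta.CombHId2CopySum (biLoc_tsum_family)
open Summit.QuantumFields.BalabanUV.Beta.CombHId2Words (W_family)
open Summit.QuantumFields.BalabanUV.Beta.CombHId2Record (periodCov_SpureCombOf periodCov_tabsM translate_inv_GcombSh exists_farSmall_WcombOf perF_dper_tsum_T2comb_succ)
open Summit.QuantumFields.BalabanUV.Beta.CombHId2W2SymSwap (fmperiodCov_of_shiftK_cov)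
open Summit.QuantumFields.BalabanUV.Beta.CombHId2W2Record (exists_locStencil₂_T2comb T2comb_translate exists_locStencilFM_M2comb WcombOf_per_cs_eq)
open Summit.QuantumFields.BalabanUV.Beta.CombHId2Torus (perF_dM_dper perF_vertexOfM_dper_apply perZ_coarse_coarse_eq_perF)
open Summit.QuantumFields.BalabanUV.Beta.CombHId2FoldsSlots (perF_vertex2OfK_csf_per perF_mixOfK_cs_per)
open Summit.QuantumFields.BalabanUV.Beta.CombHId2TorusWords (perF_dM_K2OfK_dper_apply perF_e4OfKW_dper_inl_inl)
open Summit.QuantumFields.BalabanUV.Beta.CombHId2TorusSym (perF_W2OfK_slots perF_W2SymOfK_slots exists_decays_W2SymOfK_slots)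

variable {d : ℕ} (M : Fin (d + 1) → ℕ) [∀ μ, NeZero (M μ)]
variable {Lc : ℕ} [NeZero Lc] {M' : Fin (d + 1) → ℕ} (tabs : SymTables d Lc) (cE cVH cΛ cE₂ cB : ℝ) (T : Fin 4 → Fin 4 → Fin 4 → Fin 4 → ℝ)

/-! ## §1 The record's `W` slot on the torus: the sockets of `CombHId2TorusWords` discharged -/

section WSockets

omit [∀ μ, NeZero (M μ)] [NeZero Lc] in
/-- [folklore] the `(Tmix)` bridge at the record: `M2Of mixFF j` is jointly period covariant on every fine box `M = Lc·M′` (`CombHId2W2SymSwap.fmperiodCov_of_shiftK_cov` on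
`BalabanStepW2.M2Of_translate tabs.hmixt`). -/
theorem M2comb_periodCov (hM : ∀ i, M i = Lc * M' i) (j : ℕ) (κ : Fin (d + 1)) (u : Site (d + 1)) (ρ : Fin (d + 1)) (w m x z : Site (d + 1)) (a c : Fib d) :
    M2Of d Lc tabs.mixFF j κ (translate M u m) ρ (translate M' w m) (translate M x m) (translate M z m) a c = M2Of d Lc tabs.mixFF j κ u ρ w x z a c :=
  fmperiodCov_of_shiftK_cov M hM (M2Of_translate (Lc := Lc) tabs.hmixt j) κ u ρ w m x z a c

/-- [folklore] the record's door-bound `W` slot `W2SymOfK G Lc S^per M^per T2^{per,csf} M2^{per,cs} b b′` is invariant under the fine period lattice (it IS `dper M` of the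
copy-summed `WcombOf` — `CombHId2W2Record.WcombOf_per_cs_eq` — and `dper` is invariant). -/
theorem W2SymOfK_comb_translate_inv (hM : ∀ i, M i = Lc * M' i) (j : ℕ) (μ : Fin (d + 1)) (y : Site (d + 1)) (ν : Fin (d + 1)) (y' : Site (d + 1))
    (m x z : Site (d + 1)) (a b : Fib d) :
    W2SymOfK (GcombSh (d := d) Lc j) Lc (fun κ u => dper M (SpureCombOf tabs cE cVH cΛ j κ u)) (fun ρ w => dper M (tabs.M j ρ w))
        (fun κ u κ' u' => dper M (fun x z a c => ∑' n : Site (d + 1),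
          T2RecOf d Lc (GcombSh Lc) (SpureCombOf tabs cE cVH cΛ) tabs.M cE₂ cB T tabs.vh₂S tabs.mixFF j κ u κ' (translate M u' n) x z a c))
        (fun κ u ρ w => dper M (fun x z a c => ∑' n : Site (d + 1), M2Of d Lc tabs.mixFF j κ u ρ (translate M' w n) x z a c)) μ y ν y'
        (translate M x m) (translate M z m) a b
      = W2SymOfK (GcombSh (d := d) Lc j) Lc (fun κ u => dper M (SpureCombOf tabs cE cVH cΛ j κ u)) (fun ρ w => dper M (tabs.M j ρ w))
        (fun κ u κ' u' => dper M (fun x z a c => ∑' n : Site (d + 1),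
          T2RecOf d Lc (GcombSh Lc) (SpureCombOf tabs cE cVH cΛ) tabs.M cE₂ cB T tabs.vh₂S tabs.mixFF j κ u κ' (translate M u' n) x z a c))
        (fun κ u ρ w => dper M (fun x z a c => ∑' n : Site (d + 1), M2Of d Lc tabs.mixFF j κ u ρ (translate M' w n) x z a c)) μ y ν y' x z a b := by
  have h := congrFun (congrFun (congrFun (congrFun (WcombOf_per_cs_eq M tabs cE cVH cΛ cE₂ cB T hM j) μ) y) ν) y'
  rw [← h]
  exact dper_translate M _ m x z a b

/-- [folklore] … and decays (the far-small copy family of `CombHId2Record.exists_farSmall_WcombOf` through C3d-i `W_family`, C3c `biLoc_tsum_family`, gan24-p3's `decays_dper_diag`). -/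
theorem exists_decays_W2SymOfK_comb (hM : ∀ i, M i = Lc * M' i) (j : ℕ) (μ : Fin (d + 1)) (y : Site (d + 1)) (ν : Fin (d + 1)) (y' : Site (d + 1)) :
    ∃ C δ : ℝ, 0 < δ ∧ 0 ≤ C ∧ Decays
      (W2SymOfK (GcombSh (d := d) Lc j) Lc (fun κ u => dper M (SpureCombOf tabs cE cVH cΛ j κ u)) (fun ρ w => dper M (tabs.M j ρ w))
        (fun κ u κ' u' => dper M (fun x z a c => ∑' n : Site (d + 1),
          T2RecOf d Lc (GcombSh Lc) (SpureCombOf tabs cE cVH cΛ) tabs.M cE₂ cB T tabs.vh₂S tabs.mixFF j κ u κ' (translate M u' n) x z a c))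
        (fun κ u ρ w => dper M (fun x z a c => ∑' n : Site (d + 1), M2Of d Lc tabs.mixFF j κ u ρ (translate M' w n) x z a c)) μ y ν y') C δ := by
  obtain ⟨Cw, δw, hδw, hW⟩ := exists_farSmall_WcombOf tabs cE cVH cΛ cE₂ cB T j
  obtain ⟨hT, hg, hg0⟩ := W_family M hM hW hδw μ y ν y'
  have hD := decays_dper_diag M (biLoc_tsum_family hT hg) (tsum_nonneg hg0) hδw
  refine ⟨_, _, half_pos hδw, hD.nonneg (Sum.inl 0), ?_⟩
  have h := congrFun (congrFun (congrFun (congrFun (WcombOf_per_cs_eq M tabs cE cVH cΛ cE₂ cB T hM j) μ) y) ν) y'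
  rw [← h]
  exact hD

end WSockets

/-! ## §2 The crown: the level-`(j+1)` table's coarse-torus matrix, ff entry, as the polynomial's mm entry at the coarse points -/

section Crown

variable [∀ μ, NeZero (M' μ)]

/-- [folklore] **`perF_dper_tsum_T2comb_succ_inl_inl` — THE LATTICE SIDE OF THE DOOR's `hId₂` AT THE RECORD** (`M = Lc·M′`; `G := GcombSh Lc j`, `Â := perF M G`,
`D̂_b := perF M (dM G Lc S^per_j M^per_j b)`, `Ŵ := perF M (W2SymOfK G Lc S^per_j M^per_j T2^{per,csf}_j M2^{per,cs}_j μ y ν y′)`):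
`perF M′ (dper M′ (x z ↦ Σ'_n T2_{j+1} μ y ν (y′+M′∘n) x z)) ((y₁, inl m₁),(y₂, inl m₂))
 = (cE₂·wV4 (j+1)) · (Â·D̂_{μy}·Â·D̂_{νy′}·Â + Â·D̂_{νy′}·Â·D̂_{μy}·Â − Â·Ŵ·Â)((wrapPt M (Lc•y₁), inr m₁),(wrapPt M (Lc•y₂), inr m₂))
 + (cB·wB2 (j+1)) · perF M′ (dper M′ (x z ↦ Σ'_n vh₂S μ y ν (y′+M′∘n) x z)) ((y₁, inl m₁),(y₂, inl m₂))`
— `CombHId2Record.perF_dper_tsum_T2comb_succ` + `CombHId2W2Record.WcombOf_per_cs_eq` + `CombHId2TorusWords.perF_e4OfKW_dper_inl_inl`, every socket discharged by the record's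
letters; ONE hypothesis `hM`. -/
theorem perF_dper_tsum_T2comb_succ_inl_inl (hM : ∀ i, M i = Lc * M' i) (j : ℕ) (μ : Fin (d + 1)) (y : Site (d + 1)) (ν : Fin (d + 1)) (y' : Site (d + 1))
    (y₁ y₂ : ↥(pbox M')) (m₁ m₂ : Fin (d + 1)) :
    perF M' (dper M' (fun x z a b => ∑' n, T2RecOf d Lc (GcombSh Lc) (SpureCombOf tabs cE cVH cΛ) tabs.M cE₂ cB T tabs.vh₂S tabs.mixFF (j + 1) μ y ν
        (translate M' y' n) x z a b)) (y₁, Sum.inl m₁) (y₂, Sum.inl m₂)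
      = (cE₂ * wV4 d Lc (j + 1))
          * (perF M (GcombSh (d := d) Lc j)
              * perF M (dM (GcombSh (d := d) Lc j) Lc (fun κ u => dper M (SpureCombOf tabs cE cVH cΛ j κ u)) (fun ρ w => dper M (tabs.M j ρ w)) μ y)
              * perF M (GcombSh (d := d) Lc j)
              * perF M (dM (GcombSh (d := d) Lc j) Lc (fun κ u => dper M (SpureCombOf tabs cE cVH cΛ j κ u)) (fun ρ w => dper M (tabs.M j ρ w)) ν y')
              * perF M (GcombSh (d := d) Lc j)
            + perF M (GcombSh (d := d) Lc j)
              * perF M (dM (GcombSh (d := d) Lc j) Lc (fun κ u => dper M (SpureCombOf tabs cE cVH cΛ j κ u)) (fun ρ w => dper M (tabs.M j ρ w)) ν y')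
              * perF M (GcombSh (d := d) Lc j)
              * perF M (dM (GcombSh (d := d) Lc j) Lc (fun κ u => dper M (SpureCombOf tabs cE cVH cΛ j κ u)) (fun ρ w => dper M (tabs.M j ρ w)) μ y)
              * perF M (GcombSh (d := d) Lc j)
            - perF M (GcombSh (d := d) Lc j)
              * perF M (W2SymOfK (GcombSh (d := d) Lc j) Lc (fun κ u => dper M (SpureCombOf tabs cE cVH cΛ j κ u)) (fun ρ w => dper M (tabs.M j ρ w))
                  (fun κ u κ' u' => dper M (fun x z a c => ∑' n : Site (d + 1),
                    T2RecOf d Lc (GcombSh Lc) (SpureCombOf tabs cE cVH cΛ) tabs.M cE₂ cB T tabs.vh₂S tabs.mixFF j κ u κ' (translate M u' n) x z a c))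
                  (fun κ u ρ w => dper M (fun x z a c => ∑' n : Site (d + 1), M2Of d Lc tabs.mixFF j κ u ρ (translate M' w n) x z a c)) μ y ν y')
              * perF M (GcombSh (d := d) Lc j))
            (wrapPt M ((Lc : ℤ) • (y₁ : Site (d + 1))), Sum.inr m₁) (wrapPt M ((Lc : ℤ) • (y₂ : Site (d + 1))), Sum.inr m₂)
        + (cB * wB2 d Lc (j + 1))
          * perF M' (dper M' (fun x z a b => ∑' n, tabs.vh₂S μ y ν (translate M' y' n) x z a b)) (y₁, Sum.inl m₁) (y₂, Sum.inl m₂) := by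
  have hLM : ∀ i, Lc ∣ M i := fun i => ⟨M' i, hM i⟩
  obtain ⟨δG, CG, hδG, -, hG⟩ := decays_GcombSh (d := d) (Lc := Lc) j
  obtain ⟨CS, δS, hδS, hS⟩ := locStencil_SpureCombOf tabs cE cVH cΛ j
  obtain ⟨CM, δM, hδM, hMloc⟩ := tabs.hM j
  obtain ⟨CW, δW, hδW, -, hWd⟩ := exists_decays_W2SymOfK_comb M tabs cE cVH cΛ cE₂ cB T hM j μ y ν y'
  have hE := perF_e4OfKW_dper_inl_inl M hM (translate_inv_GcombSh M hLM j) hG hδG (periodCov_SpureCombOf M tabs cE cVH cΛ hLM j) hS hδS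
    (periodCov_tabsM M tabs hM j) hMloc hδM μ y ν y' (W2SymOfK_comb_translate_inv M tabs cE cVH cΛ cE₂ cB T hM j μ y ν y') hWd hδW y₁ y₂ m₁ m₂
  rw [perF_dper_tsum_T2comb_succ M tabs cE cVH cΛ cE₂ cB T hM j μ y ν y', WcombOf_per_cs_eq M tabs cE cVH cΛ cE₂ cB T hM j, Matrix.add_apply,
    Matrix.smul_apply, Matrix.smul_apply, smul_eq_mul, smul_eq_mul, hE]

end Crown

/-! ## §3 The letters of the polynomial, READ at the record (one hypothesis `hM`) -/

section Letters

variable [∀ μ, NeZero (M' μ)]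

omit [∀ μ, NeZero (M' μ)] in
/-- [folklore] `D̂_b = perF M (vertexOfK G Lc S^per_j b) + perF M (vertexOfM G Lc M^per_j b)` (`CombHId2Torus.perF_dM_dper` at the record). -/
theorem perF_dM_comb (hM : ∀ i, M i = Lc * M' i) (j : ℕ) (μ : Fin (d + 1)) (y : Site (d + 1)) :
    perF M (dM (GcombSh (d := d) Lc j) Lc (fun κ u => dper M (SpureCombOf tabs cE cVH cΛ j κ u)) (fun ρ w => dper M (tabs.M j ρ w)) μ y)
      = perF M (vertexOfK (GcombSh (d := d) Lc j) Lc (fun κ u => dper M (SpureCombOf tabs cE cVH cΛ j κ u)) μ y)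
        + perF M (vertexOfM (GcombSh (d := d) Lc j) Lc (fun ρ w => dper M (tabs.M j ρ w)) μ y) := by
  have hLM : ∀ i, Lc ∣ M i := fun i => ⟨M' i, hM i⟩
  obtain ⟨δG, CG, hδG, -, hG⟩ := decays_GcombSh (d := d) (Lc := Lc) j
  obtain ⟨CS, δS, hδS, hS⟩ := locStencil_SpureCombOf tabs cE cVH cΛ j
  obtain ⟨CM, δM, hδM, hMloc⟩ := tabs.hM j
  exact perF_dM_dper M hM (translate_inv_GcombSh M hLM j) hG hδG (periodCov_SpureCombOf M tabs cE cVH cΛ hLM j) hS hδS (periodCov_tabsM M tabs hM j) hMloc hδM μ y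

omit [∀ μ, NeZero (M' μ)] in
/-- [folklore] **the `Θ`-column reading of the first field vertex at the record**: `perF M (vertexOfK G Lc S^per_j μ y) P Q = Σ_{u∈pbox M,κ} Â((u, inl κ),(wrapPt M (Lc•y), inr μ)) · perF M (S^per_j κ u) P Q`
(C2b `perF_vertexOfK_dper_apply` + C2a `perZ_coarse_col_eq_perF`). -/
theorem perF_vertexOfK_comb_apply (hM : ∀ i, M i = Lc * M' i) (j : ℕ) (μ : Fin (d + 1)) (y : Site (d + 1)) (P Q : Idx M (Fib d)) :
    perF M (vertexOfK (GcombSh (d := d) Lc j) Lc (fun κ u => dper M (SpureCombOf tabs cE cVH cΛ j κ u)) μ y) P Q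
      = ∑ u : ↥(pbox M), ∑ κ : Fin (d + 1), perF M (GcombSh (d := d) Lc j) (u, Sum.inl κ) (wrapPt M ((Lc : ℤ) • y), Sum.inr μ)
          * perF M (dper M (SpureCombOf tabs cE cVH cΛ j κ (u : Site (d + 1)))) P Q := by
  have hLM : ∀ i, Lc ∣ M i := fun i => ⟨M' i, hM i⟩
  obtain ⟨δG, CG, hδG, -, hG⟩ := decays_GcombSh (d := d) (Lc := Lc) j
  obtain ⟨CS, δS, hδS, hS⟩ := locStencil_SpureCombOf tabs cE cVH cΛ j
  rw [perF_vertexOfK_dper_apply M (translate_inv_GcombSh M hLM j) hG hδG (periodCov_SpureCombOf M tabs cE cVH cΛ hLM j) hS hδS μ y P Q]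
  simp only [perZ_coarse_col_eq_perF]

/-- [folklore] **the `Ŝ`-column reading of the multiplier vertex at the record**:
`perF M (vertexOfM G Lc M^per_j μ y) P Q = Σ_{w∈pbox M′,ρ} Â((wrapPt M (Lc•w), inr ρ),(wrapPt M (Lc•y), inr μ)) · perF M (M^per_j ρ w) P Q` (`CombHId2Torus` §4). -/
theorem perF_vertexOfM_comb_apply (hM : ∀ i, M i = Lc * M' i) (j : ℕ) (μ : Fin (d + 1)) (y : Site (d + 1)) (P Q : Idx M (Fib d)) :
    perF M (vertexOfM (GcombSh (d := d) Lc j) Lc (fun ρ w => dper M (tabs.M j ρ w)) μ y) P Q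
      = ∑ w : ↥(pbox M'), ∑ ρ : Fin (d + 1),
          perF M (GcombSh (d := d) Lc j) (wrapPt M ((Lc : ℤ) • (w : Site (d + 1))), Sum.inr ρ) (wrapPt M ((Lc : ℤ) • y), Sum.inr μ)
            * perF M (dper M (tabs.M j ρ (w : Site (d + 1)))) P Q := by
  have hLM : ∀ i, Lc ∣ M i := fun i => ⟨M' i, hM i⟩
  obtain ⟨δG, CG, hδG, -, hG⟩ := decays_GcombSh (d := d) (Lc := Lc) j
  obtain ⟨CM, δM, hδM, hMloc⟩ := tabs.hM j
  rw [perF_vertexOfM_dper_apply M hM (translate_inv_GcombSh M hLM j) hG hδG (periodCov_tabsM M tabs hM j) hMloc hδM μ y P Q]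
  simp only [perZ_coarse_coarse_eq_perF M (translate_inv_GcombSh M hLM j)]

/-- [folklore] **`Ŵ` SPLITS**: `perF M (W2SymOfK G Lc S^per_j M^per_j T2^{per,csf}_j M2^{per,cs}_j μ y ν y′) = ½ • (perF M (W2OfK … μ y ν y′) + perF M (W2OfK … ν y′ μ y))`
(`CombHId2TorusSym.perF_W2SymOfK_slots` at the record). -/
theorem perF_W2SymOfK_comb (hM : ∀ i, M i = Lc * M' i) (j : ℕ) (μ : Fin (d + 1)) (y : Site (d + 1)) (ν : Fin (d + 1)) (y' : Site (d + 1)) :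
    perF M (W2SymOfK (GcombSh (d := d) Lc j) Lc (fun κ u => dper M (SpureCombOf tabs cE cVH cΛ j κ u)) (fun ρ w => dper M (tabs.M j ρ w))
        (fun κ u κ' u' => dper M (fun x z a c => ∑' n : Site (d + 1),
          T2RecOf d Lc (GcombSh Lc) (SpureCombOf tabs cE cVH cΛ) tabs.M cE₂ cB T tabs.vh₂S tabs.mixFF j κ u κ' (translate M u' n) x z a c))
        (fun κ u ρ w => dper M (fun x z a c => ∑' n : Site (d + 1), M2Of d Lc tabs.mixFF j κ u ρ (translate M' w n) x z a c)) μ y ν y')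
      = (1 / 2 : ℝ) • (perF M (W2OfK (GcombSh (d := d) Lc j) Lc (fun κ u => dper M (SpureCombOf tabs cE cVH cΛ j κ u)) (fun ρ w => dper M (tabs.M j ρ w))
            (fun κ u κ' u' => dper M (fun x z a c => ∑' n : Site (d + 1),
              T2RecOf d Lc (GcombSh Lc) (SpureCombOf tabs cE cVH cΛ) tabs.M cE₂ cB T tabs.vh₂S tabs.mixFF j κ u κ' (translate M u' n) x z a c))
            (fun κ u ρ w => dper M (fun x z a c => ∑' n : Site (d + 1), M2Of d Lc tabs.mixFF j κ u ρ (translate M' w n) x z a c)) μ y ν y')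
          + perF M (W2OfK (GcombSh (d := d) Lc j) Lc (fun κ u => dper M (SpureCombOf tabs cE cVH cΛ j κ u)) (fun ρ w => dper M (tabs.M j ρ w))
            (fun κ u κ' u' => dper M (fun x z a c => ∑' n : Site (d + 1),
              T2RecOf d Lc (GcombSh Lc) (SpureCombOf tabs cE cVH cΛ) tabs.M cE₂ cB T tabs.vh₂S tabs.mixFF j κ u κ' (translate M u' n) x z a c))
            (fun κ u ρ w => dper M (fun x z a c => ∑' n : Site (d + 1), M2Of d Lc tabs.mixFF j κ u ρ (translate M' w n) x z a c)) ν y' μ y)) := by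
  have hLM : ∀ i, Lc ∣ M i := fun i => ⟨M' i, hM i⟩
  obtain ⟨δG, CG, hδG, -, hG⟩ := decays_GcombSh (d := d) (Lc := Lc) j
  obtain ⟨CS, δS, hδS, hS⟩ := locStencil_SpureCombOf tabs cE cVH cΛ j
  obtain ⟨CM, δM, hδM, hMloc⟩ := tabs.hM j
  obtain ⟨C₂, δ₂, hδ₂, hS₂⟩ := exists_locStencil₂_T2comb tabs cE cVH cΛ cE₂ cB T j
  obtain ⟨Cm, δm, hδm, hM₂⟩ := exists_locStencilFM_M2comb tabs j
  exact perF_W2SymOfK_slots M hM (translate_inv_GcombSh M hLM j) hG hδG (periodCov_SpureCombOf M tabs cE cVH cΛ hLM j) hS hδS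
    (periodCov_tabsM M tabs hM j) hMloc hδM (T2comb_translate tabs cE cVH cΛ cE₂ cB T j) hS₂ hδ₂ (M2comb_periodCov M tabs hM j) hM₂ hδm μ y ν y'

/-- [folklore] **THE FOUR WORDS**: `perF M (W2OfK G Lc S^per_j M^per_j T2^{per,csf}_j M2^{per,cs}_j μ y ν y′) = perF M (vertex2OfK G Lc T2^{per,csf}_j μ y ν y′)
+ perF M (mixOfK G Lc M2^{per,cs}_j μ y ν y′) + perF M (mixOfK G Lc M2^{per,cs}_j ν y′ μ y) + perF M (dM (K2OfK G Lc S^per_j M^per_j ν y′) Lc S^per_j M^per_j μ y)` (`CombHId2TorusSym.perF_W2OfK_slots`). -/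
theorem perF_W2OfK_comb (hM : ∀ i, M i = Lc * M' i) (j : ℕ) (μ : Fin (d + 1)) (y : Site (d + 1)) (ν : Fin (d + 1)) (y' : Site (d + 1)) :
    perF M (W2OfK (GcombSh (d := d) Lc j) Lc (fun κ u => dper M (SpureCombOf tabs cE cVH cΛ j κ u)) (fun ρ w => dper M (tabs.M j ρ w))
        (fun κ u κ' u' => dper M (fun x z a c => ∑' n : Site (d + 1),
          T2RecOf d Lc (GcombSh Lc) (SpureCombOf tabs cE cVH cΛ) tabs.M cE₂ cB T tabs.vh₂S tabs.mixFF j κ u κ' (translate M u' n) x z a c))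
        (fun κ u ρ w => dper M (fun x z a c => ∑' n : Site (d + 1), M2Of d Lc tabs.mixFF j κ u ρ (translate M' w n) x z a c)) μ y ν y')
      = perF M (vertex2OfK (GcombSh (d := d) Lc j) Lc (fun κ u κ' u' => dper M (fun x z a c => ∑' n : Site (d + 1),
            T2RecOf d Lc (GcombSh Lc) (SpureCombOf tabs cE cVH cΛ) tabs.M cE₂ cB T tabs.vh₂S tabs.mixFF j κ u κ' (translate M u' n) x z a c)) μ y ν y')
        + perF M (mixOfK (GcombSh (d := d) Lc j) Lc
            (fun κ u ρ w => dper M (fun x z a c => ∑' n : Site (d + 1), M2Of d Lc tabs.mixFF j κ u ρ (translate M' w n) x z a c)) μ y ν y')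
        + perF M (mixOfK (GcombSh (d := d) Lc j) Lc
            (fun κ u ρ w => dper M (fun x z a c => ∑' n : Site (d + 1), M2Of d Lc tabs.mixFF j κ u ρ (translate M' w n) x z a c)) ν y' μ y)
        + perF M (dM (K2OfK (GcombSh (d := d) Lc j) Lc (fun κ u => dper M (SpureCombOf tabs cE cVH cΛ j κ u)) (fun ρ w => dper M (tabs.M j ρ w)) ν y') Lc
            (fun κ u => dper M (SpureCombOf tabs cE cVH cΛ j κ u)) (fun ρ w => dper M (tabs.M j ρ w)) μ y) := by
  have hLM : ∀ i, Lc ∣ M i := fun i => ⟨M' i, hM i⟩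
  obtain ⟨δG, CG, hδG, -, hG⟩ := decays_GcombSh (d := d) (Lc := Lc) j
  obtain ⟨CS, δS, hδS, hS⟩ := locStencil_SpureCombOf tabs cE cVH cΛ j
  obtain ⟨CM, δM, hδM, hMloc⟩ := tabs.hM j
  obtain ⟨C₂, δ₂, hδ₂, hS₂⟩ := exists_locStencil₂_T2comb tabs cE cVH cΛ cE₂ cB T j
  obtain ⟨Cm, δm, hδm, hM₂⟩ := exists_locStencilFM_M2comb tabs j
  exact perF_W2OfK_slots M hM (translate_inv_GcombSh M hLM j) hG hδG (periodCov_SpureCombOf M tabs cE cVH cΛ hLM j) hS hδS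
    (periodCov_tabsM M tabs hM j) hMloc hδM (T2comb_translate tabs cE cVH cΛ cE₂ cB T j) hS₂ hδ₂ (M2comb_periodCov M tabs hM j) hM₂ hδm μ y ν y'

omit [∀ μ, NeZero (M' μ)] in
/-- [folklore] **`H₂`'s BINDING AT THE RECORD**: `perF M (vertex2OfK G Lc T2^{per,csf}_j μ y ν y′) P Q = Σ_{u,κ} Σ_{u′,κ′} Â((u, inl κ),(wrapPt M (Lc•y), inr μ)) · (Â((u′, inl κ′),(wrapPt M (Lc•y′), inr ν)) ·
perF M (T2^{per,csf}_j κ u κ′ u′) P Q)` (`CombHId2FoldsSlots.perF_vertex2OfK_csf_per` on the record's `(T2t)`, `(L2)`). -/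
theorem perF_vertex2OfK_comb (hM : ∀ i, M i = Lc * M' i) (j : ℕ) (μ : Fin (d + 1)) (y : Site (d + 1)) (ν : Fin (d + 1)) (y' : Site (d + 1))
    (P Q : Idx M (Fib d)) :
    perF M (vertex2OfK (GcombSh (d := d) Lc j) Lc (fun κ u κ' u' => dper M (fun x z a c => ∑' n : Site (d + 1),
        T2RecOf d Lc (GcombSh Lc) (SpureCombOf tabs cE cVH cΛ) tabs.M cE₂ cB T tabs.vh₂S tabs.mixFF j κ u κ' (translate M u' n) x z a c)) μ y ν y') P Q
      = ∑ u : ↥(pbox M), ∑ κ : Fin (d + 1), ∑ u' : ↥(pbox M), ∑ κ' : Fin (d + 1),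
          perF M (GcombSh (d := d) Lc j) (u, Sum.inl κ) (wrapPt M ((Lc : ℤ) • y), Sum.inr μ)
            * (perF M (GcombSh (d := d) Lc j) (u', Sum.inl κ') (wrapPt M ((Lc : ℤ) • y'), Sum.inr ν)
                * perF M (dper M (fun x z a c => ∑' n : Site (d + 1), T2RecOf d Lc (GcombSh Lc) (SpureCombOf tabs cE cVH cΛ) tabs.M cE₂ cB T tabs.vh₂S
                    tabs.mixFF j κ (u : Site (d + 1)) κ' (translate M (u' : Site (d + 1)) n) x z a c)) P Q) := by
  have hLM : ∀ i, Lc ∣ M i := fun i => ⟨M' i, hM i⟩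
  obtain ⟨δG, CG, hδG, -, hG⟩ := decays_GcombSh (d := d) (Lc := Lc) j
  obtain ⟨C₂, δ₂, hδ₂, hS₂⟩ := exists_locStencil₂_T2comb tabs cE cVH cΛ cE₂ cB T j
  exact perF_vertex2OfK_csf_per M hM (translate_inv_GcombSh M hLM j) hG hδG (T2comb_translate tabs cE cVH cΛ cE₂ cB T j) hS₂ hδ₂ μ y ν y' P Q

/-- [folklore] **`Q₁₂`'s BINDING AT THE RECORD** (either order of the bonds): `perF M (mixOfK G Lc M2^{per,cs}_j μ y ν y′) P Q = Σ_{u,κ} Σ_{w∈pbox M′,ρ} Â((u, inl κ),(wrapPt M (Lc•y), inr μ)) ·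
(Â((wrapPt M (Lc•w), inr ρ),(wrapPt M (Lc•y′), inr ν)) · perF M (M2^{per,cs}_j κ u ρ w) P Q)` (`CombHId2FoldsSlots.perF_mixOfK_cs_per` on `(Tmix)`, `(Lmix₂)`). -/
theorem perF_mixOfK_comb (hM : ∀ i, M i = Lc * M' i) (j : ℕ) (μ : Fin (d + 1)) (y : Site (d + 1)) (ν : Fin (d + 1)) (y' : Site (d + 1))
    (P Q : Idx M (Fib d)) :
    perF M (mixOfK (GcombSh (d := d) Lc j) Lc
        (fun κ u ρ w => dper M (fun x z a c => ∑' n : Site (d + 1), M2Of d Lc tabs.mixFF j κ u ρ (translate M' w n) x z a c)) μ y ν y') P Q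
      = ∑ u : ↥(pbox M), ∑ κ : Fin (d + 1), ∑ w : ↥(pbox M'), ∑ ρ : Fin (d + 1),
          perF M (GcombSh (d := d) Lc j) (u, Sum.inl κ) (wrapPt M ((Lc : ℤ) • y), Sum.inr μ)
            * (perF M (GcombSh (d := d) Lc j) (wrapPt M ((Lc : ℤ) • (w : Site (d + 1))), Sum.inr ρ) (wrapPt M ((Lc : ℤ) • y'), Sum.inr ν)
                * perF M (dper M (fun x z a c => ∑' n : Site (d + 1), M2Of d Lc tabs.mixFF j κ (u : Site (d + 1)) ρ (translate M' (w : Site (d + 1)) n) x z a c))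
                    P Q) := by
  have hLM : ∀ i, Lc ∣ M i := fun i => ⟨M' i, hM i⟩
  obtain ⟨δG, CG, hδG, -, hG⟩ := decays_GcombSh (d := d) (Lc := Lc) j
  obtain ⟨Cm, δm, hδm, hM₂⟩ := exists_locStencilFM_M2comb tabs j
  exact perF_mixOfK_cs_per M hM (translate_inv_GcombSh M hLM j) hG hδG (M2comb_periodCov M tabs hM j) hM₂ hδm μ y ν y' P Q

/-- [folklore] **THE RESPONSE WORD AT THE RECORD**: `perF M (dM (K2OfK G Lc S^per_j M^per_j ν y′) Lc S^per_j M^per_j μ y) P Q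
= Σ_{u,κ} (−(Â·D̂_{νy′}·Â))((u, inl κ),(wrapPt M (Lc•y), inr μ)) · perF M (S^per_j κ u) P Q + Σ_{w,ρ} (−(Â·D̂_{νy′}·Â))((wrapPt M (Lc•w), inr ρ),(wrapPt M (Lc•y), inr μ)) · perF M (M^per_j ρ w) P Q`
(`CombHId2TorusWords.perF_dM_K2OfK_dper_apply` at the record). -/
theorem perF_resp_comb (hM : ∀ i, M i = Lc * M' i) (j : ℕ) (μ : Fin (d + 1)) (y : Site (d + 1)) (ν : Fin (d + 1)) (y' : Site (d + 1)) (P Q : Idx M (Fib d)) :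
    perF M (dM (K2OfK (GcombSh (d := d) Lc j) Lc (fun κ u => dper M (SpureCombOf tabs cE cVH cΛ j κ u)) (fun ρ w => dper M (tabs.M j ρ w)) ν y') Lc
        (fun κ u => dper M (SpureCombOf tabs cE cVH cΛ j κ u)) (fun ρ w => dper M (tabs.M j ρ w)) μ y) P Q
      = ∑ u : ↥(pbox M), ∑ κ : Fin (d + 1),
            (-(perF M (GcombSh (d := d) Lc j)
                * perF M (dM (GcombSh (d := d) Lc j) Lc (fun κ u => dper M (SpureCombOf tabs cE cVH cΛ j κ u)) (fun ρ w => dper M (tabs.M j ρ w)) ν y')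
                * perF M (GcombSh (d := d) Lc j)))
                (u, Sum.inl κ) (wrapPt M ((Lc : ℤ) • y), Sum.inr μ) * perF M (dper M (SpureCombOf tabs cE cVH cΛ j κ (u : Site (d + 1)))) P Q
        + ∑ w : ↥(pbox M'), ∑ ρ : Fin (d + 1),
            (-(perF M (GcombSh (d := d) Lc j)
                * perF M (dM (GcombSh (d := d) Lc j) Lc (fun κ u => dper M (SpureCombOf tabs cE cVH cΛ j κ u)) (fun ρ w => dper M (tabs.M j ρ w)) ν y')
                * perF M (GcombSh (d := d) Lc j)))
                (wrapPt M ((Lc : ℤ) • (w : Site (d + 1))), Sum.inr ρ) (wrapPt M ((Lc : ℤ) • y), Sum.inr μ)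
              * perF M (dper M (tabs.M j ρ (w : Site (d + 1)))) P Q := by
  have hLM : ∀ i, Lc ∣ M i := fun i => ⟨M' i, hM i⟩
  obtain ⟨δG, CG, hδG, -, hG⟩ := decays_GcombSh (d := d) (Lc := Lc) j
  obtain ⟨CS, δS, hδS, hS⟩ := locStencil_SpureCombOf tabs cE cVH cΛ j
  obtain ⟨CM, δM, hδM, hMloc⟩ := tabs.hM j
  exact perF_dM_K2OfK_dper_apply M hM (translate_inv_GcombSh M hLM j) hG hδG (periodCov_SpureCombOf M tabs cE cVH cΛ hLM j) hS hδS
    (periodCov_tabsM M tabs hM j) hMloc hδM μ y ν y' P Q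

end Letters

end Summit.QuantumFields.BalabanUV.Beta.CombHId2TorusRecord

end
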